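import Mathlib
import HarnessLib

/-!
# The two-line case of top-prime rigidity, part 2: the coefficient calculus of bilinear forms

Helper file for crux `CoverDecancellation` (stmt-ValiantsHypothesis-17819), line `component_rigidity` (val-idea-10 g3),
stub C `stub_twoLineCase_of_topPrimeRigidity` (director-valiant g13 R215 (P3) / R216 (c); critic val-idea-crit-3 g3
PRICE 3, sub-lemma C-ii «the 8×8 dichotomy … then the derivative identity»).  Pure bookkeeping, NO definitions: a
homogeneous quadric `a` of `S`-weight `1` (a BILINEAR form across the split `S | Sᶜ` of the variables, as produced by
C-i `TwoLine.bilinear_projection`) is the explicit double sum `Σ_{s ∈ S} Σ_{t ∉ S} coeff(e_s + e_t, a) · x_s x_t`, so its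
values and its partial derivatives in the `Sᶜ`-variables are the obvious finite sums — the entries of the `8 × 8` matrix
`N(y₀)` of the line's card.

* `exists_eq_single_add_single` — a degree-`2` exponent of `S`-weight `1` is `e_s + e_t` with `s ∈ S`, `t ∉ S`.
* `eq_sum_coeff_smul_X_mul_X` — the explicit double-sum form of a bilinear `a`.
* `eval_bilinear` — `eval x a = Σ_{s ∈ S} Σ_{t ∉ S} coeff(e_s + e_t, a) · x_s · x_t`.
* `eval_pderiv_bilinear` — for `t₀ ∉ S`: `eval x (∂_{t₀} a) = Σ_{s ∈ S} coeff(e_s + e_{t₀}, a) · x_s` (independent of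
  the `Sᶜ`-coordinates of `x`).

HONEST FRAMING: helper layer toward ONE registered stub of an OPEN line; crux 17819 `CoverDecancellation` stays HELD;
nothing here bears on `VP ≠ VNP`, which is NOT proved. [folklore]
-/

set_option autoImplicit false

-- the mandated summit-side namespace repeats a component by design (single-problem summit)
set_option linter.dupNamespace false

noncomputable section

open MvPolynomial

namespace Summit.ValiantsHypothesis.ValiantsHypothesis.Theorems.PolyaContinuedLaplaceRigidity

namespace TwoLine

/-- the indicator weight of `S` is the sum of the exponents over `S` -/
theorem weight_indicator_eq_sum {σ : Type*} [Fintype σ] [DecidableEq σ] (S : Finset σ)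
    (d : σ →₀ ℕ) : Finsupp.weight (fun e => if e ∈ S then 1 else 0) d = ∑ e ∈ S, d e := by
  rw [Finsupp.weight_apply, Finsupp.sum_fintype _ _ (by simp)]
  simp only [smul_eq_mul, mul_ite, mul_one, mul_zero]
  rw [← Finset.sum_filter, Finset.filter_univ_mem]

/-- the standard weight is the total degree `Σ_e d e` -/
theorem weight_one_eq_sum {σ : Type*} [Fintype σ] (d : σ →₀ ℕ) :
    Finsupp.weight (1 : σ → ℕ) d = ∑ e, d e := by
  classical
  rw [Finsupp.weight_apply, Finsupp.sum_fintype _ _ (by simp)]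
  simp

/-- a sum of naturals over a finset equal to `1` is carried by one element -/
theorem exists_eq_one_of_sum_eq_one {σ : Type*} [DecidableEq σ] (S : Finset σ) (f : σ → ℕ)
    (h : ∑ e ∈ S, f e = 1) : ∃ s ∈ S, f s = 1 ∧ ∀ s' ∈ S, s' ≠ s → f s' = 0 := by
  obtain ⟨s, hs, hfs⟩ := Finset.exists_ne_zero_of_sum_ne_zero (by rw [h]; exact one_ne_zero)
  have hle : f s ≤ 1 := by rw [← h]; exact Finset.single_le_sum (fun _ _ => Nat.zero_le _) hs
  have hfs1 : f s = 1 := by omega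
  refine ⟨s, hs, hfs1, fun s' hs' hne => ?_⟩
  have hsub : ({s, s'} : Finset σ) ⊆ S := by
    intro x hx
    rcases Finset.mem_insert.1 hx with rfl | hx
    · exact hs
    · rw [Finset.mem_singleton.1 hx]; exact hs'
  have h2 : ∑ e ∈ ({s, s'} : Finset σ), f e ≤ ∑ e ∈ S, f e :=
    Finset.sum_le_sum_of_subset_of_nonneg hsub fun _ _ _ => Nat.zero_le _
  rw [Finset.sum_pair hne.symm, h, hfs1] at h2
  omega

/-- **A degree-`2` exponent of `S`-weight `1` is `e_s + e_t` with `s ∈ S`, `t ∉ S`.** -/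
theorem exists_eq_single_add_single {σ : Type*} [Fintype σ] [DecidableEq σ] (S : Finset σ)
    {d : σ →₀ ℕ} (h2 : Finsupp.weight (1 : σ → ℕ) d = 2)
    (h1 : Finsupp.weight (fun e => if e ∈ S then 1 else 0) d = 1) :
    ∃ s ∈ S, ∃ t ∈ Sᶜ, d = Finsupp.single s 1 + Finsupp.single t 1 := by
  rw [weight_indicator_eq_sum] at h1
  rw [weight_one_eq_sum] at h2
  have hT : ∑ e ∈ Sᶜ, d e = 1 := by
    have := Finset.sum_add_sum_compl S (fun e => d e)
    rw [h1, h2] at this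
    omega
  obtain ⟨s, hs, hds, hs'⟩ := exists_eq_one_of_sum_eq_one S (fun e => d e) h1
  obtain ⟨t, ht, hdt, ht'⟩ := exists_eq_one_of_sum_eq_one Sᶜ (fun e => d e) hT
  refine ⟨s, hs, t, ht, Finsupp.ext fun e => ?_⟩
  have hst : s ≠ t := fun h => (Finset.mem_compl.1 ht) (h ▸ hs)
  simp only [Finsupp.add_apply, Finsupp.single_apply]
  by_cases hes : s = e
  · subst hes
    rw [if_pos rfl, if_neg (Ne.symm hst)]; simpa using hds
  by_cases het : t = e
  · subst het
    rw [if_neg hes, if_pos rfl]; simpa using hdt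
  rw [if_neg hes, if_neg het]
  by_cases heS : e ∈ S
  · simpa using hs' e heS (Ne.symm hes)
  · simpa using ht' e (Finset.mem_compl.2 heS) (Ne.symm het)

/-- injectivity of `(s, t) ↦ e_s + e_t` on `S × Sᶜ`, first coordinate -/
theorem fst_eq_of_single_add_single_eq {σ : Type*} [Fintype σ] [DecidableEq σ] (S : Finset σ)
    {s s' t t' : σ}
    (hs : s ∈ S) (hs' : s' ∈ S) (ht : t ∈ Sᶜ) (ht' : t' ∈ Sᶜ)
    (h : Finsupp.single s 1 + Finsupp.single t 1 = Finsupp.single s' 1 + Finsupp.single t' 1) :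
    s = s' ∧ t = t' := by
  have hts : t ≠ s := fun e => (Finset.mem_compl.1 ht) (e ▸ hs)
  have ht's : t' ≠ s := fun e => (Finset.mem_compl.1 ht') (e ▸ hs)
  have hst' : s ≠ t' := fun e => (Finset.mem_compl.1 ht') (e ▸ hs)
  have hs't' : s' ≠ t' := fun e => (Finset.mem_compl.1 ht') (e ▸ hs')
  have h1 := congrArg (fun f => f s) h
  have h2 := congrArg (fun f => f t') h
  simp only [Finsupp.add_apply, Finsupp.single_apply, if_neg hts, if_neg ht's] at h1
  simp only [Finsupp.add_apply, Finsupp.single_apply, if_neg hst', if_neg hs't'] at h2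
  constructor
  · by_contra hne
    rw [if_neg (Ne.symm hne)] at h1
    simp at h1
  · by_contra hne
    rw [if_neg hne] at h2
    simp at h2

/-- **The explicit double-sum form of a bilinear form**: a homogeneous quadric of `S`-weight `1` is
`Σ_{s ∈ S} Σ_{t ∉ S} coeff(e_s + e_t, a) · x_s x_t`. -/
theorem eq_sum_coeff_smul_X_mul_X {σ : Type*} [Fintype σ] [DecidableEq σ] (S : Finset σ)
    {a : MvPolynomial σ ℂ} (h2 : a.IsHomogeneous 2)
    (h1 : IsWeightedHomogeneous (fun e => if e ∈ S then 1 else 0) a 1) :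
    a = ∑ s ∈ S, ∑ t ∈ Sᶜ, coeff (Finsupp.single s 1 + Finsupp.single t 1) a • (X s * X t) := by
  have hXX : ∀ s t : σ, (X s * X t : MvPolynomial σ ℂ) =
      monomial (Finsupp.single s 1 + Finsupp.single t 1) 1 := by
    intro s t
    show monomial (Finsupp.single s 1) (1 : ℂ) * monomial (Finsupp.single t 1) 1 = _
    rw [monomial_mul, mul_one]
  ext d
  simp only [coeff_sum, coeff_smul, hXX, coeff_monomial, smul_eq_mul, mul_ite, mul_one, mul_zero]
  by_cases hd : coeff d a = 0
  · rw [hd]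
    symm
    refine Finset.sum_eq_zero fun s _ => Finset.sum_eq_zero fun t _ => ?_
    split_ifs with h
    · rw [h, hd]
    · rfl
  · obtain ⟨s₀, hs₀, t₀, ht₀, rfl⟩ := exists_eq_single_add_single S (h2 hd) (h1 hd)
    symm
    rw [Finset.sum_eq_single_of_mem s₀ hs₀, Finset.sum_eq_single_of_mem t₀ ht₀, if_pos rfl]
    · intro t ht hne
      rw [if_neg]
      intro h
      exact hne (fst_eq_of_single_add_single_eq S hs₀ hs₀ ht ht₀ h).2
    · intro s hs hne
      refine Finset.sum_eq_zero fun t ht => ?_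
      rw [if_neg]
      intro h
      exact hne (fst_eq_of_single_add_single_eq S hs hs₀ ht ht₀ h).1

/-- **Values of a bilinear form**: `eval x a = Σ_{s ∈ S} Σ_{t ∉ S} coeff(e_s + e_t, a) · x_s · x_t`. -/
theorem eval_bilinear {σ : Type*} [Fintype σ] [DecidableEq σ] (S : Finset σ)
    {a : MvPolynomial σ ℂ} (h2 : a.IsHomogeneous 2)
    (h1 : IsWeightedHomogeneous (fun e => if e ∈ S then 1 else 0) a 1) (x : σ → ℂ) :
    eval x a = ∑ s ∈ S, ∑ t ∈ Sᶜ, coeff (Finsupp.single s 1 + Finsupp.single t 1) a * (x s * x t) := by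
  conv_lhs => rw [eq_sum_coeff_smul_X_mul_X S h2 h1]
  simp only [map_sum, smul_eval, map_mul, eval_X]

/-- **Partial derivatives of a bilinear form in an `Sᶜ`-variable**: for `t₀ ∉ S`,
`eval x (∂_{t₀} a) = Σ_{s ∈ S} coeff(e_s + e_{t₀}, a) · x_s`, whatever the `Sᶜ`-coordinates of `x`. -/
theorem eval_pderiv_bilinear {σ : Type*} [Fintype σ] [DecidableEq σ] (S : Finset σ)
    {a : MvPolynomial σ ℂ} (h2 : a.IsHomogeneous 2)
    (h1 : IsWeightedHomogeneous (fun e => if e ∈ S then 1 else 0) a 1) (x : σ → ℂ)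
    {t₀ : σ} (ht₀ : t₀ ∈ Sᶜ) :
    eval x (pderiv t₀ a) = ∑ s ∈ S, coeff (Finsupp.single s 1 + Finsupp.single t₀ 1) a * x s := by
  conv_lhs => rw [eq_sum_coeff_smul_X_mul_X S h2 h1]
  rw [map_sum, map_sum]
  refine Finset.sum_congr rfl fun s hs => ?_
  have hst₀ : s ≠ t₀ := fun e => (Finset.mem_compl.1 ht₀) (e ▸ hs)
  rw [map_sum, map_sum]
  have hterm : ∀ t ∈ Sᶜ,
      eval x (pderiv t₀ (coeff (Finsupp.single s 1 + Finsupp.single t 1) a • (X s * X t : MvPolynomial σ ℂ))) =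
        if t = t₀ then coeff (Finsupp.single s 1 + Finsupp.single t 1) a * x s else 0 := by
    intro t _
    rw [Derivation.map_smul, smul_eval, pderiv_mul, pderiv_X_of_ne hst₀, zero_mul, zero_add]
    by_cases ht : t = t₀
    · subst ht
      rw [pderiv_X_self, mul_one, eval_X, if_pos rfl]
    · rw [pderiv_X_of_ne ht, mul_zero, map_zero, mul_zero, if_neg ht]
  rw [Finset.sum_congr rfl hterm, Finset.sum_ite_eq' Sᶜ t₀, if_pos ht₀]

end TwoLine

end Summit.ValiantsHypothesis.ValiantsHypothesis.Theorems.PolyaContinuedLaplaceRigidity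

end
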